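import Literature.AnabelianGeometry.AbsoluteAnabelian.ArchimedeanHolFieldFunctorGeometricPuncturedTorusOuter
import HarnessLib

/-!
# [AbsTopIII] Prop. 4.2 (i) for every once-punctured elliptic curve in the TYPED sense
# (`IsPuncturedEllipticCurve`): «objects of `EA` mapping to `𝕏`» is id-rigid, unconditionally

S. Mochizuki, *Topics in Absolute Anabelian Geometry III*, Prop. 4.2 (i) p.106 with Cor. 2.7 (a)
(once-punctured elliptic curves). [cite: MochizukiAbsTopIII2015, Proposition 4.2 (i) p.106]

PROOF-ONLY file (abc-iut cell, seat abc-iut-w5-d144 gen 4, row «H1PRIME-ELLIPTIC», consumer-facing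
corollary; campaign-L R1.2, NODES AbsTopIII:Prop4.2(i)/Cor4.5 geometric column).  The model theorem
`HolRS.isIdRigid_mapsTo_puncturedTorus` (the explicit `E ∖ {x₀}`, `E = ℂ/Φ(ℤ²)`) is transported to
every object `𝕏` of `HolRS` whose carrier is a once-punctured elliptic curve in the typed sense of the
cell's [AbsTopIII] Cor. 2.7 vocabulary (`TorsionPointsDenseUniqueGroupLaw.IsPuncturedEllipticCurve`,
abc-iut-L4-t7/t8), through the proved model theorem `puncturedEllipticCurveModel_holds` (abc-iut-L4-t8
lineage: such an `𝕏` is biholomorphic to some `ℂ/Φ(ℤ²) ∖ {0}`):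

* `isIdRigid_mapsTo_iff_of_iso` (any category) — «objects mapping to `X`» and «objects mapping to
  `X'`» are the same full subcategory when `X ≅ X'`;
* `HolRS.nonempty_iso_of_homeomorph` — a biholomorphic homeomorphism of carriers is an isomorphism of
  `HolRS` (a homeomorphism is finite étale, abc-iut-L4-t2's `IsFiniteEtale.of_homeomorph`);
* `HolRS.isIdRigid_mapsTo_of_isPuncturedEllipticCurve` — **for every `𝕏 : HolRS` with
  `IsPuncturedEllipticCurve 𝕏.carrier`, the full subcategory of objects mapping to `𝕏` is ID-RIGID.**

Classical; no definition, no instance, no Prop fact; nothing here bears on [IUTchIII] Cor. 3.12;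
model ≠ reconstruction; support library, not a node.
-/

noncomputable section

open CategoryTheory Topology
open scoped Manifold ContDiff
open Literature.Topology.CoveringSpaces
open Literature.Geometry.Kaehler

universe v u

namespace Literature.AnabelianGeometry.AbsoluteAnabelian

/-! ### §1 «Objects mapping to `X`» only depends on the isomorphism class of `X` -/

/-- For isomorphic objects `X ≅ X'` the object properties «maps to `X`» and «maps to `X'`» coincide,
hence so do the id-rigidity statements for the corresponding full subcategories.
[cite: MochizukiAbsTopIII2015, Section 0 p.27] -/
theorem isIdRigid_mapsTo_iff_of_iso {C : Type u} [Category.{v} C] {X X' : C} (i : X ≅ X') :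
    IsIdRigid (ObjectProperty.FullSubcategory fun Y : C => Nonempty (Y ⟶ X)) ↔
      IsIdRigid (ObjectProperty.FullSubcategory fun Y : C => Nonempty (Y ⟶ X')) := by
  have h : (fun Y : C => Nonempty (Y ⟶ X)) = fun Y : C => Nonempty (Y ⟶ X') := by
    funext Y
    exact propext ⟨fun ⟨f⟩ => ⟨f ≫ i.hom⟩, fun ⟨f⟩ => ⟨f ≫ i.inv⟩⟩
  rw [h]

namespace HolRS

/-! ### §2 Biholomorphic homeomorphisms are isomorphisms of `HolRS` -/

/-- A homeomorphism of the carriers of two connected Riemann surfaces which is holomorphic in both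
directions is an isomorphism of `HolRS` (a homeomorphism is finite étale).
[cite: MochizukiAbsTopIII2015, Definition 4.1 (iii) p.103] -/
theorem nonempty_iso_of_homeomorph {X Y : HolRS} (e : X.carrier ≃ₜ Y.carrier)
    (hd : MDifferentiable 𝓘(ℂ, ℂ) 𝓘(ℂ, ℂ) e) (hd' : MDifferentiable 𝓘(ℂ, ℂ) 𝓘(ℂ, ℂ) e.symm) :
    Nonempty (X ≅ Y) :=
  ⟨⟨⟨e, hd, IsFiniteEtale.of_homeomorph e⟩, ⟨e.symm, hd', IsFiniteEtale.of_homeomorph e.symm⟩,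
    hom_ext (funext fun x => e.symm_apply_apply x), hom_ext (funext fun y => e.apply_symm_apply y)⟩⟩

/-! ### §3 Every once-punctured elliptic curve in the typed sense -/

/-- **[AbsTopIII] Prop. 4.2 (i) at every once-punctured elliptic curve, unconditionally (typed form)**:
for an object `𝕏` of `HolRS` whose carrier is a once-punctured elliptic curve in the sense of the
cell's Cor. 2.7 vocabulary (`IsPuncturedEllipticCurve`: biholomorphic to the complement of a point in
a compact Riemann surface homeomorphic to a torus), the full subcategory of objects mapping to `𝕏` is
ID-RIGID.  (`puncturedEllipticCurveModel_holds`: `𝕏^top ≅ ℂ/Φ(ℤ²) ∖ {0}` biholomorphically; transport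
of `isIdRigid_mapsTo_puncturedTorus_zero`.) [cite: MochizukiAbsTopIII2015, Proposition 4.2 (i) p.106]
[cite: MochizukiAbsTopIII2015, Corollary 2.7 (a) p.58] -/
theorem isIdRigid_mapsTo_of_isPuncturedEllipticCurve (X : HolRS)
    (hX : TorsionPointsDenseUniqueGroupLaw.IsPuncturedEllipticCurve X.carrier) :
    IsIdRigid (ObjectProperty.FullSubcategory fun Y : HolRS => Nonempty (Y ⟶ X)) := by
  obtain ⟨Φ, e, he, he'⟩ :=
    HolomorphicEllipticCuspidalization.puncturedEllipticCurveModel_holds X.carrier hX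
  obtain ⟨i⟩ := nonempty_iso_of_homeomorph (X := X) (Y := puncturedTorus Φ 0) e he he'
  rw [isIdRigid_mapsTo_iff_of_iso i]
  exact isIdRigid_mapsTo_puncturedTorus_zero Φ

end HolRS

end Literature.AnabelianGeometry.AbsoluteAnabelian
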